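import Summits.BirchSwinnertonDyer.BirchSwinnertonDyer.Theorems.EisensteinPrimesLineCharactersAtMultiplicativePlace
import Summits.BirchSwinnertonDyer.BirchSwinnertonDyer.Theorems.ByReductionTypeAtTwoMultTransportFrobenius
import HarnessLib

/-!
# Crux 2 `GoodLatticeBDPValue` (stmt-BirchSwinnertonDyer-19032), line `halves` v25, road R5 / AN-5, brick G2:
# at a NON-SPLIT multiplicative `2 ≠ p` the characters of a rational `p`-line take the values
# `{φ(2), ψ(2)} = {−2, −1}` — and hence `{φ(ℓ), ψ(ℓ)} = {−ℓ, −1}` at EVERY non-split multiplicative `ℓ ≠ p`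

Cell `bsd-eis` (home `run/shared/lean/pub/bsd-eis/`), width seat `bsd-line-x1-p1-w6` (gen 8; `--supports -19032`,
closes nothing by itself). Brick G2 of width seat `-w7` (gen 7)'s road R5 / AN-5 (make the composed-print name
`KellerYin2024.thm222_anacong_goodLattice_of_five_le` a corollary of 3a-A `…_of_fullDescentDatum` via the kernel theorem
T‴ «`5 ≤ p`, `p` good, `E[p]` reducible, no rational `p`-line unramified at `p` ⟹ full-descent datum»; bus
`STATUS.md` 2026-08-28 21:34:45Z / 21:47:17Z). The non-split dispatch of the road reads, at every non-split multiplicative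
prime `ℓ ≠ p`, `{φ(ℓ), ψ(ℓ)} = {−ℓ, −1}` for the line character `φ` and the quotient character `ψ`, whence on the
`ω`-line `ℓ + 1 ≡ 0 (mod p)` — the datum. The tree theorem
`EisensteinPrimesLineCharactersAtMultiplicativePlace.lineChars_natCast_of_not_hasSplitMultiplicativeReductionAtPrime`
(x2-p1-w7 g0) proves this for ODD `ℓ`, its only use of `ℓ ≠ 2` being the Frobenius flip of `√γ`
(`GreenbergVatsalTateFrobeniusSign.frob_apply_sqrt_gamma_ne`, Euler's criterion). At `ℓ = 2` the flip is the tree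
theorem `MultTransportAtTwo.frob_apply_sqrt_gamma_ne_two` (cell `bsd-2adic`, T-42-mult I-a: the node-tangent quadratic
replaces Euler's criterion), with the same binders. Here:

* `lineChars_natCast_of_not_hasSplitMultiplicativeReductionAtPrime_two` — the `ℓ = 2` twin, token for token (same
  proof, the `ℓ = 2` flip substituted);
* `lineChars_natCast_of_not_hasSplitMultiplicativeReductionAtPrime'` — the odd-`ℓ` theorem and the `ℓ = 2` twin
  glued: the statement of x2-p1-w7's theorem WITHOUT the hypothesis `ℓ ≠ 2`;
* `false_of_not_hasSplitMultiplicativeReductionAtPrime_two_of_omega` — the `hG2` SLOT of -w7 g7's `p`-assembly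
  `FullDescentAssemblyPrime.fullDescentDatum_of_pieces` in its binder shape: at `5 ≤ p` a curve with an `ω`-point
  `Q ≠ 0` in `W[p]` has no non-split multiplicative `2` (on `⟨Q⟩`, `(φ, ψ) = (χ̄_p, 𝟙)`, so the twin reads
  `2 ≡ −2` or `2 ≡ −1 (mod p)`, i.e. `p ∣ 2` or `p ∣ 3`).

HONEST FRAMING: tool theorems only (0 definitions, 0 named facts, 0 `sorry`); every input is a tree THEOREM (both
twisted Tate uniformisation facts are DISCHARGED in the tree); no summit statement, no BSD / IMC2 / Keller–Yin theorem, no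
stub of the registered skeleton is proved; 0 cells / labels / tiers move.

References: [GreenbergVatsal2000] §2 pp. 14–15, 27; [SilvermanATAEC1994] Ch. V Lemma 5.2 (c), Thm. 5.3, Cor. 5.4,
Ex. 5.11; [SilvermanAEC2009] VII.5 Prop. 5.1 (b); [NeukirchANT1999] Ch. I §10 (10.3), Ch. II §9 Prop. (9.6);
[Kriz2016] Thm. 34 (2).
-/

set_option autoImplicit false
set_option linter.dupNamespace false

noncomputable section

open scoped Classical Pointwise

open NumberField IsDedekindDomain Field WeierstrassCurve
  Literature.NumberTheory.EllipticCurves Literature.NumberTheory.GaloisRepresentations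
  Literature.NumberTheory.EllipticCurves.GreenbergSelmer
  Literature.NumberTheory.EllipticCurves.Rank1Residual
  Literature.NumberTheory.EllipticCurves.GreenbergVatsal2000
  Summit.BirchSwinnertonDyer.Rank1Residual.X2.GreenbergVatsalTateDatum
  Summit.BirchSwinnertonDyer.Rank1Residual.X2.GreenbergVatsalTateDatumSign
  Summit.BirchSwinnertonDyer.Rank1Residual.X2.GreenbergVatsalTateDatumCofree
  Summit.BirchSwinnertonDyer.Rank1Residual.X2
  Summit.BirchSwinnertonDyer.BirchSwinnertonDyer.Theorems.EisensteinPrimesLinePsiAtMultiplicativePrime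
  Summit.BirchSwinnertonDyer.BirchSwinnertonDyer.Theorems.EisensteinPrimesLinePhiAtMultiplicativePrime
  Summit.BirchSwinnertonDyer.BirchSwinnertonDyer.Theorems.MultTransportAtTwo

namespace Summit.BirchSwinnertonDyer.BirchSwinnertonDyer.Theorems.EisensteinPrimesLineCharactersAtMultiplicativePlace

variable {W : WeierstrassCurve ℚ} [W.IsElliptic] {p : ℕ} [hp : Fact p.Prime]

/-- **NON-SPLIT multiplicative `2 ≠ p`: `{φ(2), ψ(2)} = {−2, −1}`.** For `W/ℚ` globally minimal with NON-split
multiplicative reduction at `2 ≠ p` (place `v = (2)`), a rational line `Φ₀ ≤ W[p]` with characters `φ` mod `m ∌ 2`, `ψ`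
mod `d ∌ 2` (the tree's `hφ0`/`hψ0` shapes): either `φ(2) = −2 ∧ ψ(2) = −1` or `φ(2) = −1 ∧ ψ(2) = −2` in `𝔽_p`. The
proof of `lineChars_natCast_of_not_hasSplitMultiplicativeReductionAtPrime` verbatim, with the `2`-adic Frobenius flip
`MultTransportAtTwo.frob_apply_sqrt_gamma_ne_two` (node-tangent quadratic) in place of Euler's criterion: a local
arithmetic Frobenius acts as `−1` on the Tate quotient and as `−2` on the Tate line of the twisted uniformisation
`TateCurve.Silverman1994_thmV53_corV54_tateUniformisation_holds`. [cite: GreenbergVatsal2000, §2 pp. 14–15]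
[cite: SilvermanATAEC1994, Ch. V Lemma 5.2 (c), Thm. 5.3 (a),(b), Cor. 5.4, Ex. 5.11 (b)]
[cite: SilvermanAEC2009, VII.5 Prop. 5.1(b)] [cite: NeukirchANT1999, Ch. I §10 (10.3) and Ch. II §9 Prop. (9.6)] -/
theorem lineChars_natCast_of_not_hasSplitMultiplicativeReductionAtPrime_two [W.IsGloballyMinimal]
    {v : HeightOneSpectrum (𝓞 ℚ)}
    (hv : (Rat.HeightOneSpectrum.primesEquiv v : ℕ) = 2) (h2p : 2 ≠ p)
    (hmult : W.HasMultiplicativeReductionAtPrime 2) (hns : ¬ W.HasSplitMultiplicativeReductionAtPrime 2)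
    {Φ₀ : AddSubgroup (geomTorsion W (p : ℤ))} (hΦ : IsRationalLine W p Φ₀)
    {m : ℕ} [NeZero m] (φ : DirichletCharacter (ZMod p) m) (h2m : ¬ 2 ∣ m)
    {d : ℕ} [NeZero d] (ψ : DirichletCharacter (ZMod p) d) (h2d : ¬ 2 ∣ d)
    (hφ0 : ∀ (σ : absoluteGaloisGroup ℚ), ∀ P ∈ Φ₀,
      σ • P = (φ ((modNCyclotomicCharacter ℚ m σ : (ZMod m)ˣ) : ZMod m)).val • P)
    (hψ0 : ∀ (σ : absoluteGaloisGroup ℚ) (Q : geomTorsion W (p : ℤ)),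
      σ • Q - (ψ ((modNCyclotomicCharacter ℚ d σ : (ZMod d)ˣ) : ZMod d)).val • Q ∈ Φ₀) :
    (φ ((2 : ℕ) : ZMod m) = -((2 : ℕ) : ZMod p) ∧ ψ ((2 : ℕ) : ZMod d) = -1) ∨
      (φ ((2 : ℕ) : ZMod m) = -1 ∧ ψ ((2 : ℕ) : ZMod d) = -((2 : ℕ) : ZMod p)) := by
  -- adapted from x2-p1-w7's `lineChars_natCast_of_not_hasSplitMultiplicativeReductionAtPrime` (odd `ℓ`)
  haveI h2 : Fact (Nat.Prime 2) := ⟨Nat.prime_two⟩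
  have hpp := hp.out
  have h2v : ((2 : ℕ) : 𝓞 ℚ) ∈ v.asIdeal := natCast_mem_asIdeal_of_primesEquiv_eq hv
  have hmultAt : W.HasMultiplicativeReductionAt v :=
    GreenbergVatsalStrictSelmerMultiplicative.hasMultiplicativeReductionAt_of_mem W 2 hmult h2v
  obtain ⟨𝔐, h𝔐⟩ := v.localPrimesAbove_nonempty
  obtain ⟨τ, hτ⟩ := IsDedekindDomain.HeightOneSpectrum.exists_isArithFrobAt_localAbsIntegers v h𝔐
  obtain ⟨q, t, Ψ, hq0, hq1, ht0, ht2, hsurj, hker, hΨσ, -⟩ :=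
    TateCurve.Silverman1994_thmV53_corV54_tateUniformisation_holds W v hmultAt
  have hker' : ∀ u : (AlgebraicClosure (v.adicCompletion ℚ))ˣ, Ψ (Additive.ofMul u) = 0 →
      ∃ a : ℤ, (u : AlgebraicClosure (v.adicCompletion ℚ)) =
        algebraMap (v.adicCompletion ℚ) (AlgebraicClosure (v.adicCompletion ℚ)) q ^ a :=
    fun u h ↦ (hker u).1 h
  have hflip := frob_apply_sqrt_gamma_ne_two W hmult hns h2v h𝔐 hτ t ht0 ht2
  set N := tateDatum W p Ψ (sign_disj W Ψ t hΨσ) with hN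
  set X := N.plus.comap (AddSubgroup.inclusion (geomTorsion_le_geomPrimaryTorsion W p)) with hXdef
  have hXcard : Nat.card X = p := by
    rw [hXdef, TateLineDecomposition.natCard_comap_eq W p N, hN]
    exact natCard_tateDatum_plus_inf_torsionBy W p Ψ _ hq0 hq1 hker'
  set σ₁ : absoluteGaloisGroup ℚ := absGaloisRestrict ℚ (v.adicCompletion ℚ) τ with hσ₁def
  -- the quotient: `σ₁ ≡ −1`
  have hquot : ∀ Q : geomTorsion W (p : ℤ), σ₁ • Q - (-1 : ℤ) • Q ∈ X := fun Q ↦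
    TateLineDecomposition.smul_sub_zsmul_mem_comap W p N (g := σ₁) (s := -1) (fun m' ↦ by
      have h := smul_sub_sign_smul_mem W p Ψ t hΨσ hsurj hker' τ m'
      rwa [if_neg hflip] at h) Q
  -- the eigenvector in the Tate line: `σ₁ • P₀ = (−2) • P₀`
  obtain ⟨P₀, hP₀0, hP₀X, hP₀⟩ := exists_mem_tateLine_eigenvector (W := W) hv h2p h𝔐 hτ hq0 hq1
    hker (sign_disj W Ψ t hΨσ) (z := -1) (fun u ↦ by rw [hΨσ τ u, if_neg hflip])
  have hχm : ((modNCyclotomicCharacter ℚ m σ₁ : (ZMod m)ˣ) : ZMod m) = ((2 : ℕ) : ZMod m) :=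
    modNCyclotomicCharacter_absGaloisRestrict_frob hv h𝔐 hτ m h2m
  have hχd : ((modNCyclotomicCharacter ℚ d σ₁ : (ZMod d)ˣ) : ZMod d) = ((2 : ℕ) : ZMod d) :=
    modNCyclotomicCharacter_absGaloisRestrict_frob hv h𝔐 hτ d h2d
  have hφ : ∀ P ∈ Φ₀, σ₁ • P = (φ ((2 : ℕ) : ZMod m)).val • P := fun P hP ↦ by
    have h := hφ0 σ₁ P hP; rwa [hχm] at h
  have hψ : ∀ Q : geomTorsion W (p : ℤ), σ₁ • Q - (ψ ((2 : ℕ) : ZMod d)).val • Q ∈ Φ₀ := fun Q ↦ by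
    have h := hψ0 σ₁ Q; rwa [hχd] at h
  have key := lineChars_dichotomy hΦ.1 hXcard (fun P hP ↦ hΦ.2 σ₁ P hP) hquot hP₀X hP₀0 hP₀ hφ hψ
  simp only [ZMod.natCast_zmod_val, neg_one_mul, Int.cast_neg, Int.cast_natCast, Int.cast_one] at key
  exact key

/-- **NON-SPLIT multiplicative `ℓ ≠ p`, EVERY prime `ℓ` (the statement of
`lineChars_natCast_of_not_hasSplitMultiplicativeReductionAtPrime` without `ℓ ≠ 2`): `{φ(ℓ), ψ(ℓ)} = {−ℓ, −1}`.** For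
`W/ℚ` globally minimal with NON-split multiplicative reduction at the prime `ℓ ≠ p` (place `v = (ℓ)`), a rational line
`Φ₀ ≤ W[p]` with characters `φ` mod `m ∌ ℓ`, `ψ` mod `d ∌ ℓ`: either `φ(ℓ) = −ℓ ∧ ψ(ℓ) = −1` or
`φ(ℓ) = −1 ∧ ψ(ℓ) = −ℓ` in `𝔽_p`. Odd `ℓ`: x2-p1-w7's theorem (Euler's criterion flips `√γ`); `ℓ = 2`: the twin above
(node-tangent quadratic). [cite: GreenbergVatsal2000, §2 pp. 14–15]
[cite: SilvermanATAEC1994, Ch. V Lemma 5.2 (c), Thm. 5.3 (a),(b), Cor. 5.4, Ex. 5.11 (b)]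
[cite: SilvermanAEC2009, VII.5 Prop. 5.1(b)] [cite: Kriz2016, Thm. 34 (2)] -/
theorem lineChars_natCast_of_not_hasSplitMultiplicativeReductionAtPrime' [W.IsGloballyMinimal]
    {v : HeightOneSpectrum (𝓞 ℚ)} {ℓ : ℕ} [hℓ : Fact ℓ.Prime]
    (hv : (Rat.HeightOneSpectrum.primesEquiv v : ℕ) = ℓ) (hℓp : ℓ ≠ p)
    (hmult : W.HasMultiplicativeReductionAtPrime ℓ) (hns : ¬ W.HasSplitMultiplicativeReductionAtPrime ℓ)
    {Φ₀ : AddSubgroup (geomTorsion W (p : ℤ))} (hΦ : IsRationalLine W p Φ₀)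
    {m : ℕ} [NeZero m] (φ : DirichletCharacter (ZMod p) m) (hℓm : ¬ ℓ ∣ m)
    {d : ℕ} [NeZero d] (ψ : DirichletCharacter (ZMod p) d) (hℓd : ¬ ℓ ∣ d)
    (hφ0 : ∀ (σ : absoluteGaloisGroup ℚ), ∀ P ∈ Φ₀,
      σ • P = (φ ((modNCyclotomicCharacter ℚ m σ : (ZMod m)ˣ) : ZMod m)).val • P)
    (hψ0 : ∀ (σ : absoluteGaloisGroup ℚ) (Q : geomTorsion W (p : ℤ)),
      σ • Q - (ψ ((modNCyclotomicCharacter ℚ d σ : (ZMod d)ˣ) : ZMod d)).val • Q ∈ Φ₀) :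
    (φ (ℓ : ZMod m) = -(ℓ : ZMod p) ∧ ψ (ℓ : ZMod d) = -1) ∨
      (φ (ℓ : ZMod m) = -1 ∧ ψ (ℓ : ZMod d) = -(ℓ : ZMod p)) := by
  rcases eq_or_ne ℓ 2 with rfl | hℓ2
  · exact lineChars_natCast_of_not_hasSplitMultiplicativeReductionAtPrime_two (W := W) hv hℓp hmult hns hΦ
      φ hℓm ψ hℓd hφ0 hψ0
  · exact lineChars_natCast_of_not_hasSplitMultiplicativeReductionAtPrime hv hℓp hℓ2 hmult hns hΦ φ hℓm ψ hℓd
      hφ0 hψ0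

/-- **The `hG2` slot of the `p`-assembly (`FullDescentAssemblyPrime.fullDescentDatum_of_pieces`, width seat -w7 g7): at
`5 ≤ p` a globally minimal `W/ℚ` carrying an `ω`-POINT `Q ≠ 0` of `W[p]` (`σ • Q = χ̄_p(σ) • Q`) has NO non-split
multiplicative reduction at `2`.** On the rational line `⟨Q⟩` the characters are `(φ, ψ) = (χ̄_p, 𝟙)` (the quotient
character is `det · φ⁻¹ = 𝟙`, `Mazur1978.smul_sub_smul_mem_zmultiples_of_isogenyCharacter`), so the `ℓ = 2` twin reads
`(2, 1) = (−2, −1)` or `(2, 1) = (−1, −2)` in `𝔽_p`, i.e. `p ∣ 2` or `p ∣ 3` — absurd for `5 ≤ p`. Stated in the slot's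
binder shape (`ℓ = 2` as a hypothesis on a `Fact ℓ.Prime` index). [cite: Kriz2016, Thm. 34 (2)]
[cite: GreenbergVatsal2000, §2 pp. 14–15] [cite: SilvermanAEC2009, VII.5 Prop. 5.1(b)] -/
theorem false_of_not_hasSplitMultiplicativeReductionAtPrime_two_of_omega [W.IsGloballyMinimal] (h5 : 5 ≤ p)
    {ℓ : ℕ} [hℓ : Fact ℓ.Prime] (hℓ2 : ℓ = 2)
    (hmult : W.HasMultiplicativeReductionAtPrime ℓ) (hns : ¬ W.HasSplitMultiplicativeReductionAtPrime ℓ)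
    (Q : geomTorsion W (p : ℤ)) (hQ0 : Q ≠ 0)
    (hQ : ∀ σ : absoluteGaloisGroup ℚ,
      σ • Q = ((modNCyclotomicCharacter ℚ p σ : (ZMod p)ˣ) : ZMod p).val • Q) :
    False := by
  subst hℓ2
  have hpp := hp.out
  have h2p : 2 ≠ p := by omega
  haveI : Fact (2 < p) := ⟨by omega⟩
  haveI : NeZero p := ⟨hpp.ne_zero⟩
  -- the place `v = (2)`
  set v : HeightOneSpectrum (𝓞 ℚ) := Rat.HeightOneSpectrum.primesEquiv.symm ⟨2, Nat.prime_two⟩ with hvdef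
  have hv : (Rat.HeightOneSpectrum.primesEquiv v : ℕ) = 2 := by
    rw [hvdef, Equiv.apply_symm_apply]
  -- the rational line `⟨Q⟩`
  have hΦ : IsRationalLine W p (AddSubgroup.zmultiples Q) := by
    refine ⟨?_, fun σ P hP ↦ ?_⟩
    · rw [Nat.card_zmultiples, addOrderOf_eq_prime (AddSubgroup.torsionBy.nsmul Q) hQ0]
    · obtain ⟨k, rfl⟩ := AddSubgroup.mem_zmultiples_iff.mp hP
      have h1 : σ • (k • Q) = k • (σ • Q) := map_zsmul (DistribSMul.toAddMonoidHom _ σ) k Q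
      rw [h1, hQ σ]
      exact AddSubgroup.zsmul_mem _ (AddSubgroup.nsmul_mem _ (AddSubgroup.mem_zmultiples Q) _) _
  -- `2` is a unit mod `p` and mod `1`
  have h2m : ¬ 2 ∣ p := fun h ↦ h2p ((Nat.prime_dvd_prime_iff_eq Nat.prime_two hpp).mp h)
  have h2d : ¬ 2 ∣ 1 := by omega
  have hcop : Nat.Coprime 2 p := (Nat.coprime_primes Nat.prime_two hpp).mpr h2p
  -- the identity Dirichlet character mod `p` with values in `ℤ/p`
  set idχ : DirichletCharacter (ZMod p) p := MulChar.ofUnitHom (MonoidHom.id (ZMod p)ˣ) with hidχ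
  have hidχ_apply : ∀ w : (ZMod p)ˣ, idχ (w : ZMod p) = (w : ZMod p) := fun w ↦ by
    rw [hidχ, MulChar.ofUnitHom_coe, MonoidHom.id_apply]
  have hidχ_2 : idχ ((2 : ℕ) : ZMod p) = ((2 : ℕ) : ZMod p) := by
    rw [← ZMod.coe_unitOfCoprime 2 hcop, hidχ_apply]
  have hone_2 : (1 : DirichletCharacter (ZMod p) 1) ((2 : ℕ) : ZMod 1) = 1 :=
    MulChar.one_apply (isUnit_of_subsingleton _)
  -- the `ω`-line: `φ = χ̄_p` (mod `p`), `ψ = 𝟙` (mod `1`)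
  have hφ0 : ∀ σ : absoluteGaloisGroup ℚ, ∀ P ∈ AddSubgroup.zmultiples Q,
      σ • P = (idχ ((modNCyclotomicCharacter ℚ p σ : (ZMod p)ˣ) : ZMod p)).val • P := by
    intro σ P hP
    obtain ⟨k, rfl⟩ := AddSubgroup.mem_zmultiples_iff.mp hP
    have h1 : σ • (k • Q) = k • (σ • Q) := map_zsmul (DistribSMul.toAddMonoidHom _ σ) k Q
    rw [hidχ_apply, h1, hQ σ, smul_comm]
  have hψ0 : ∀ (σ : absoluteGaloisGroup ℚ) (S : geomTorsion W (p : ℤ)),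
      σ • S - ((1 : DirichletCharacter (ZMod p) 1)
        ((modNCyclotomicCharacter ℚ 1 σ : (ZMod 1)ˣ) : ZMod 1)).val • S ∈ AddSubgroup.zmultiples Q := by
    intro σ S
    have h := Mazur1978.smul_sub_smul_mem_zmultiples_of_isogenyCharacter W p hQ0 hQ σ S
    rw [modPCyclotomicCharacterZMod_eq_modNCyclotomicCharacter] at h
    have hval : ((1 : DirichletCharacter (ZMod p) 1)
        ((modNCyclotomicCharacter ℚ 1 σ : (ZMod 1)ˣ) : ZMod 1)).val =
          (((modNCyclotomicCharacter ℚ p σ : (ZMod p)ˣ) : ZMod p) *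
            (((modNCyclotomicCharacter ℚ p σ)⁻¹ : (ZMod p)ˣ) : ZMod p)).val := by
      rw [MulChar.one_apply_coe, Units.mul_inv]
    rwa [← hval] at h
  rcases lineChars_natCast_of_not_hasSplitMultiplicativeReductionAtPrime_two (W := W) hv h2p hmult hns hΦ idχ h2m
      (1 : DirichletCharacter (ZMod p) 1) h2d hφ0 hψ0 with ⟨-, hψ⟩ | ⟨hφ, -⟩
  · -- `ψ(2) = 1 = −1` in `𝔽_p`: `p ∣ 2`
    rw [hone_2] at hψ
    exact ZMod.neg_one_ne_one hψ.symm
  · -- `φ(2) = 2 = −1` in `𝔽_p`: `p ∣ 3`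
    rw [hidχ_2] at hφ
    have h3 : ((3 : ℕ) : ZMod p) = 0 := by
      rw [show (3 : ℕ) = 2 + 1 from rfl, Nat.cast_add, hφ, Nat.cast_one, neg_add_cancel]
    have hdvd : p ∣ 3 := (ZMod.natCast_eq_zero_iff 3 p).mp h3
    have : p ≤ 3 := Nat.le_of_dvd (by norm_num) hdvd
    omega

end Summit.BirchSwinnertonDyer.BirchSwinnertonDyer.Theorems.EisensteinPrimesLineCharactersAtMultiplicativePlace

end
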